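import Mathlib.AlgebraicGeometry.ProjectiveSpectrum.Basic
import Mathlib.AlgebraicGeometry.Morphisms.Smooth
import Mathlib.RingTheory.Smooth.StandardSmoothOfFree
import Mathlib.RingTheory.Smooth.StandardSmoothCotangent
import Mathlib.RingTheory.Kaehler.Polynomial
import Mathlib.RingTheory.MvPolynomial.Ideal
import Summits.Ventures.HodgeRepro2.T6A2ProjChart

/-!
# T6A2ProjSmooth — projective space is smooth of relative dimension `n`

Cell pub-hodge-repro2, Tier 6 (README §10), seat t6-p2 (A2 owner; gen 12, custodial). Piece (W-c) of the
non-vacuity record for DATA row 12 (README §10.5(ii)(c)): the structure morphism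
`Proj R[X₀..Xₙ] ⟶ Spec (R[X]₀) ⟶ Spec R` of the host's `projectiveSpace n R` (host Varieties.lean ll. 40–44) is
`SmoothOfRelativeDimension n`. Smoothness is Zariski-local on the source; on the chart `D₊(Xᵢ) = Spec (R[X]_{Xᵢ})₀`
the morphism is `Spec` of `R[X]₀ → (R[X]_{Xᵢ})₀`, which under `R[X]₀ = R` (`homogeneousSubmodule_zero`) and the
chart identification `(R[X]_{Xᵢ})₀ ≅ R[Xⱼ/Xᵢ : j ≠ i]` (T6A2ProjChart) is the structure map of a polynomial ring
in `n` variables — standard smooth of relative dimension `n` by Mathlib's presentation-free criterion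
(`IsStandardSmooth.of_basis_kaehlerDifferential`, `IsStandardSmoothOfRelativeDimension.iff_of_isStandardSmooth`).
The second factor `Spec (R[X]₀) ⟶ Spec R` is an isomorphism (relative dimension `0`). Mathlib only; no display;
no `sorry`; standard axioms.
§8(d): uses an L-value-free non-vanishing device: NO.
Filed in Tier-6 WAVE 1 (2026-08-26) as p437924 (definition lane, ACCEPTED 10:27Z, commit fb4f88cf7a5c); this v2 differs from the filed bytes in this module docstring only (the staged-record wording dropped).
-/

namespace Summit.Ventures.HodgeRepro2.T6.A2Surface

open MvPolynomial HomogeneousLocalization AlgebraicGeometry CategoryTheory Algebra KaehlerDifferential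

attribute [local instance] MvPolynomial.gradedAlgebra

universe u

section PolynomialRing

variable (R : Type*) [CommRing R]

/-- The polynomial ring in finitely many variables is standard smooth over its base ring:
`H¹(R[σ]/R) = 0` (formal smoothness) and `Ω[R[σ]/R]` is free on `{d Xᵢ}`. -/
theorem isStandardSmooth_mvPolynomial (σ : Type*) [Finite σ] :
    IsStandardSmooth R (MvPolynomial σ R) := by
  refine IsStandardSmooth.of_basis_kaehlerDifferential (mvPolynomialBasis R σ) ?_
  rintro _ ⟨i, rfl⟩
  refine ⟨MvPolynomial.X i, ?_⟩
  apply (mvPolynomialBasis R σ).repr.injective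
  rw [mvPolynomialBasis_repr_D_X, Module.Basis.repr_self]

/-- The polynomial ring in the variables `σ` over a nontrivial ring is standard smooth of relative dimension
`#σ` (the rank of `Ω[R[σ]/R]` is `#σ`). -/
theorem isStandardSmoothOfRelativeDimension_mvPolynomial [Nontrivial R] (σ : Type*) [Fintype σ] :
    IsStandardSmoothOfRelativeDimension (Fintype.card σ) R (MvPolynomial σ R) := by
  haveI := isStandardSmooth_mvPolynomial R σ
  rw [IsStandardSmoothOfRelativeDimension.iff_of_isStandardSmooth,
    rank_eq_card_basis (mvPolynomialBasis R σ)]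

end PolynomialRing

section DegreeZero

variable (R : Type u) [CommRing R] (σ : Type*)

/-- `R → R[X]₀` is bijective (`R[X]₀ = R`, `homogeneousSubmodule_zero`). -/
theorem algebraMap_degreeZero_bijective :
    Function.Bijective (algebraMap R (homogeneousSubmodule σ R 0)) := by
  constructor
  · intro a b h
    have := congrArg Subtype.val h
    simp only [SetLike.GradeZero.coe_algebraMap, MvPolynomial.algebraMap_eq] at this
    exact C_injective σ R this
  · intro z
    have hz : (z : MvPolynomial σ R) ∈ (1 : Submodule R (MvPolynomial σ R)) := by
      rw [← homogeneousSubmodule_zero]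
      exact z.2
    obtain ⟨r, hr⟩ := Submodule.mem_one.mp hz
    exact ⟨r, Subtype.ext hr⟩

/-- the ring isomorphism `R ≃ R[X]₀` -/
noncomputable def degreeZeroEquiv : R ≃+* homogeneousSubmodule σ R 0 :=
  RingEquiv.ofBijective _ (algebraMap_degreeZero_bijective R σ)

/-- the underlying ring map of `degreeZeroEquiv` is the structure map `R → R[X]₀` -/
theorem degreeZeroEquiv_toRingHom :
    (degreeZeroEquiv R σ).toRingHom = algebraMap R (homogeneousSubmodule σ R 0) := rfl

/-- `Spec (R[X]₀) ⟶ Spec R` is an isomorphism -/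
theorem isIso_Spec_map_degreeZero (τ : Type) :
    IsIso (Spec.map (CommRingCat.ofHom (algebraMap R (homogeneousSubmodule τ R 0)))) := by
  have : CommRingCat.ofHom (algebraMap R (homogeneousSubmodule τ R 0)) =
      (degreeZeroEquiv R τ).toCommRingCatIso.hom := rfl
  rw [this]
  infer_instance

/-- the structure map `R[X]₀ → (R[X]_{Xᵢ})₀` factors through `R` -/
theorem fromZeroRingHom_eq (i : σ) :
    fromZeroRingHom (homogeneousSubmodule σ R) (Submonoid.powers (X i)) =
      (chartAlgebraMap R i).comp (degreeZeroEquiv R σ).symm.toRingHom := by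
  rw [chartAlgebraMap, RingHom.comp_assoc, ← degreeZeroEquiv_toRingHom,
    RingEquiv.toRingHom_comp_symm_toRingHom, RingHom.comp_id]

end DegreeZero

section Chart

variable (R : Type u) [CommRing R] [Nontrivial R] (n : ℕ)

/-- the number of coordinates on the chart `D₊(Xᵢ) ⊂ ℙⁿ` is `n` -/
theorem card_ne_fin_succ (i : Fin (n + 1)) : Fintype.card {j : Fin (n + 1) // j ≠ i} = n := by
  simp [Fintype.card_subtype_compl]

/-- on the chart `D₊(Xᵢ) ⊂ ℙⁿ_R`, the structure map `R[X]₀ → (R[X]_{Xᵢ})₀` is standard smooth of relative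
dimension `n` -/
theorem isStandardSmoothOfRelativeDimension_fromZeroRingHom (i : Fin (n + 1)) :
    RingHom.IsStandardSmoothOfRelativeDimension n
      (fromZeroRingHom (homogeneousSubmodule (Fin (n + 1)) R) (Submonoid.powers (X i))) := by
  have hP := RingHom.isStandardSmoothOfRelativeDimension_respectsIso (n := n)
  have h0 : RingHom.IsStandardSmoothOfRelativeDimension n
      (algebraMap R (MvPolynomial {j : Fin (n + 1) // j ≠ i} R)) := by
    rw [RingHom.isStandardSmoothOfRelativeDimension_algebraMap]
    have h := isStandardSmoothOfRelativeDimension_mvPolynomial R {j : Fin (n + 1) // j ≠ i}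
    rwa [card_ne_fin_succ n i] at h
  have h1 := hP.left _ (chartEquiv R i) h0
  rw [chartEquiv_comp_algebraMap] at h1
  have h2 := hP.right _ (degreeZeroEquiv R (Fin (n + 1))).symm h1
  rwa [← fromZeroRingHom_eq] at h2

omit [Nontrivial R] in
/-- the irrelevant ideal of `R[X]` is contained in `(X₀, …, Xₙ)` -/
theorem irrelevant_le_span_range_X {σ : Type*} :
    (HomogeneousIdeal.irrelevant (homogeneousSubmodule σ R)).toIdeal ≤
      Ideal.span (Set.range (X : σ → MvPolynomial σ R)) := by
  rw [HomogeneousIdeal.toIdeal_irrelevant_le]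
  intro d hd p hp
  have hp' : (p : MvPolynomial σ R).IsHomogeneous d := hp
  have := (mem_pow_idealOfVars_iff' (σ := σ) (R := R) 1 p).2 fun m hm =>
    hp'.coeff_eq_zero (by omega)
  simpa using this

/-- the standard affine open cover of `ℙⁿ_R = Proj R[X₀..Xₙ]` by the charts `D₊(Xᵢ) = Spec (R[X]_{Xᵢ})₀` -/
noncomputable def projChartCover : (Proj (homogeneousSubmodule (Fin (n + 1)) R)).AffineOpenCover :=
  Proj.affineOpenCoverOfIrrelevantLESpan (homogeneousSubmodule (Fin (n + 1)) R) X (m := fun _ => 1)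
    (fun i => X_mem_homogeneousSubmodule_one R i) (fun _ => Nat.one_pos) (irrelevant_le_span_range_X R)

omit [Nontrivial R] in
/-- the `i`-th map of the chart cover is the open immersion `D₊(Xᵢ) ⟶ Proj` -/
theorem projChartCover_f (i : Fin (n + 1)) :
    (projChartCover R n).openCover.f i =
      Proj.awayι (homogeneousSubmodule (Fin (n + 1)) R) (X i) (X_mem_homogeneousSubmodule_one R i)
        Nat.one_pos := rfl

/-- on the chart `D₊(Xᵢ)`, `Proj R[X₀..Xₙ] ⟶ Spec (R[X]₀)` is smooth of relative dimension `n` -/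
theorem smoothOfRelativeDimension_awayι_toSpecZero (i : Fin (n + 1)) :
    SmoothOfRelativeDimension n
      (Proj.awayι (homogeneousSubmodule (Fin (n + 1)) R) (X i) (X_mem_homogeneousSubmodule_one R i)
        Nat.one_pos ≫ Proj.toSpecZero (homogeneousSubmodule (Fin (n + 1)) R)) := by
  rw [Proj.awayι_toSpecZero, HasRingHomProperty.Spec_iff (P := @SmoothOfRelativeDimension n)]
  refine RingHom.locally_of (RingHom.isStandardSmoothOfRelativeDimension_respectsIso (n := n)) _ ?_
  rw [CommRingCat.hom_ofHom]
  exact isStandardSmoothOfRelativeDimension_fromZeroRingHom R n i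

/-- `Proj R[X₀..Xₙ] ⟶ Spec (R[X]₀)` is smooth of relative dimension `n` -/
theorem smoothOfRelativeDimension_toSpecZero :
    SmoothOfRelativeDimension n (Proj.toSpecZero (homogeneousSubmodule (Fin (n + 1)) R)) :=
  IsZariskiLocalAtSource.of_openCover (P := @SmoothOfRelativeDimension n)
    (projChartCover R n).openCover fun i => smoothOfRelativeDimension_awayι_toSpecZero R n i

/-- THE SMOOTHNESS CLAUSE: the structure morphism of `ℙⁿ_R`, in the host's form
`Proj.toSpecZero 𝒜 ≫ Spec.map (algebraMap R (𝒜 0))` (Varieties.lean ll. 40–44), is smooth of relative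
dimension `n`. -/
theorem smoothOfRelativeDimension_projectiveSpace :
    SmoothOfRelativeDimension n (Proj.toSpecZero (homogeneousSubmodule (Fin (n + 1)) R) ≫
      Spec.map (CommRingCat.ofHom (algebraMap R (homogeneousSubmodule (Fin (n + 1)) R 0)))) := by
  haveI := smoothOfRelativeDimension_toSpecZero R n
  haveI := isIso_Spec_map_degreeZero R (Fin (n + 1))
  exact inferInstanceAs (SmoothOfRelativeDimension (n + 0) (_ ≫ _))

end Chart

end Summit.Ventures.HodgeRepro2.T6.A2Surface
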